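import Summits.QuantumFields.BalabanUV.T4Continuum.Support.GaugeTermInstanceGeom
import Summits.QuantumFields.BalabanUV.T4Continuum.Support.ScalarCovariantLaplacianLaws
import Summits.QuantumFields.BalabanUV.T4Continuum.Support.EffectiveLaplacianExcess
import Summits.QuantumFields.BalabanUV.T4Continuum.Spine.NE2BalabanClosure

/-!
# T⁴ programme, spine node NE2 (U1a), tier B row B4.b — THE B4 SLOT OF ROOT B ON ROW DATA ONLY: row B4.e's END
# `perturbationLaws_scalarLayer` and row B4.d's hypothesis-free END `freeTowerLaws_king_scalar` plugged in BY NAME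

ROUND-2 swarm `t4-ne2-formalise-*`, leaf prover 05 (GEN 2), row **B4.b**, wiring file 4.  `Support/GaugeTermInstanceGeom` (file 3) gave the
gauge slot's target shape `PerturbationLaws (Δ_a ⊗ 1) (gaugeSlot R Q_U Q_1 a′) (J ⊗ 1) κ₄ (C₄·L^{−k})` from the scalar tower's two law
bundles keyed on `J0pcT ⊗ 1`.  Row B4.e's END (leaf-01, `ScalarCovariantLaplacianLaws.perturbationLaws_scalarLayer`) produces the perturbation
bundle from the hypothesis STRUCTURES `ConnectionLaws0 L M R α β β′ ζ` (size ∕ lattice-Lipschitz ∕ two-level consistency of the connection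
`n_k(R − 1)` and of the zeroth-order field — rows B5 ∕ B6 = NE3 currencies) and `SiteTransportLaws0 L M T τ τ′` (site transports: small field
and two-level consistency), with `κs = kappaS d a′ α β τ` and the geometric consistency constant `C2S` (`e2S_le_geom`); row B4.d's END
(leaf-04, `EffectiveLaplacianExcess.freeTowerLaws_king_scalar`) IS the free bundle, HYPOTHESIS-FREE (`d ≥ 1`, `a′ > 0`), with
`e₀ = 2d√(γ′⁻¹)·L^{−k}`, `e₁ = (2d√(γ′⁻¹) + CX d a′)·L^{−k}`.  Here:
 * §0 `kappaGS_eq_kappa4S`, `C4S_eq_closure` (`rfl`): file 3's constants ARE leaf-08's `NE2BalabanClosure.kappa4S` ∕ `C4S` (the two parallel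
   glue files agree definitionally);
 * §1 the `connL`-keyed connection binders of file 3 READ OFF `ConnectionLaws0` (`connL c R μ i = connS c R μ i.1`, `tau`∕`parT` act on the
   site component — definitional);
 * §2 **`perturbationLaws_gaugeSlot_data`**: generic free bundle `hfree : FreeTowerLaws (k ↦ DeltaPs n_k M a′ ⊗ₖ 1) A (k ↦ J0pcT L M k ⊗ₖ 1)
   F r e₀ e₁ f` with geometric `e₀ e₁`, `hR : ConnectionLaws0 …`, `hT : SiteTransportLaws0 …`, `kappaS d a′ α β τ < 1` and `σ₀⁻²·δK < 1`
   ⟹ the gauge slot's target shape — row B4.e's END consumed BY NAME (`hpert := perturbationLaws_scalarLayer hd ha′ hfree hR hT`);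
 * §3 **`perturbationLaws_gaugeSlot_balabanData`**: §2 with `hfree := KroneckerLift.freeTowerLaws_kron o (freeTowerLaws_king_scalar …)` —
   THE B4 SLOT WITH EVERY BINDER A ROW's DATA SHAPE: `ConnectionLaws0`, `SiteTransportLaws0` and the two displayed smallness inequalities
   `kappaS d a′ α β τ < 1`, `σ₀⁻²·deltaK … < 1`; constants `kappaGS …`, `C4data …` explicit;
 * the ROOT-B corollaries are row B7's (leaf-08: `Spine/NE2BalabanClosure` ∕ `NE2BalabanWiring` ∕ the announced `NE2BalabanFinal`, which
   takes `hP₄ :=` §3 BY NAME); no root corollary is restated here.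

HONEST FRAMING (T4-DAG p. 1).  Assembly (`exact`s + definitional read-offs), OURS; `R`, `T`, `a′` DATA, the structures are hypothesis
SHAPES on data (no `def … : Prop` fact; nothing printed is a hypothesis); MODEL LEVEL, no assertion of the dictionary B0 (c5: no claim that
`R`, `T`, `Q_U` are Bałaban's `U_k(V)`, `R(U(Γ))`, `Q′(U_k)`); GLOBAL small field; CONDITIONAL on node NE3 (c2∕c7), the regularity class (c3)
and Ecov's laws as displayed (c4); carver's ruling c1 stands; finite torus, linear layer, operator norm; NOT [B9] (3.23)–(3.26) as printed;
**NE2 NOT PROVED**; NOT infinite volume, NOT a mass gap, NOT Clay, NOT summit progress; spine 0/9 unchanged.  HONEST DEPENDENCY: continuum YM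
on T⁴ ⇐ BetaPertH ∧ nine spine estimates (0/9 proved); BetaPertH ⇐ (D1) ∧ (D4) ∧ CAP+tail; G-an2-4 gates asym, D1 and NE2/3/4.
ABSOLUTE RULE kept; no `sorry`.
-/

noncomputable section

open scoped BigOperators ComplexConjugate Matrix Matrix.Norms.L2Operator Kronecker ComplexOrder

namespace Summit.QuantumFields.BalabanUV.T4Continuum.GaugeTermBalabanData

open Literature.MathematicalPhysics.QuantumFieldTheory.Balaban1983to89.B5Prop11Plancherel
open Literature.MathematicalPhysics.QuantumFieldTheory.Balaban1983to89.B5G183RateUnitTower (lev lev_neZero)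
open Summit.QuantumFields.BalabanUV.T4Continuum
open Summit.QuantumFields.BalabanUV.T4Continuum.BalabanAveragedTowerUnit (idx one_le_lev' cast_lev')
open Summit.QuantumFields.BalabanUV.T4Continuum.BackgroundResolventTower
open Summit.QuantumFields.BalabanUV.T4Continuum.KingPairingPlantedLaw
open Summit.QuantumFields.BalabanUV.T4Continuum.KroneckerLift
open Summit.QuantumFields.BalabanUV.T4Continuum.BlockMultiplication
open Summit.QuantumFields.BalabanUV.T4Continuum.BalabanAveragedTowerModes (par)
open Summit.QuantumFields.BalabanUV.T4Continuum.GaugeTermDecomposition (connL)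
open Summit.QuantumFields.BalabanUV.T4Continuum.GaugeTermSandwichLaw
open Summit.QuantumFields.BalabanUV.T4Continuum.GaugeTermLayer
open Summit.QuantumFields.BalabanUV.T4Continuum.GaugeTermPerturbationLaw
open Summit.QuantumFields.BalabanUV.T4Continuum.GaugeTermScalarData
open Summit.QuantumFields.BalabanUV.T4Continuum.GaugeTermInstance
open Summit.QuantumFields.BalabanUV.T4Continuum.GaugeTermInstanceGeom
open Summit.QuantumFields.BalabanUV.T4Continuum.ScalarAveragedPropagator (DeltaPs Gps gammaPs gammaPs_pos)
open Summit.QuantumFields.BalabanUV.T4Continuum.ScalarAveragedCompression (sigma0)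
open Summit.QuantumFields.BalabanUV.T4Continuum.ScalarCovariantLaplacian (connS scalarPert kappaS)
open Summit.QuantumFields.BalabanUV.T4Continuum.ScalarCovariantLaplacianLaws (ConnectionLaws0 SiteTransportLaws0 e2S C2S
  e2S_le_geom perturbationLaws_scalarLayer)
open Summit.QuantumFields.BalabanUV.T4Continuum.ScalarPlantingDefect (Q0lev J0pcT)
open Summit.QuantumFields.BalabanUV.T4Continuum.EffectiveLaplacianExcess (CX freeTowerLaws_king_scalar)
open Summit.QuantumFields.BalabanUV.T4Continuum.BlockPairingGeometry (tau parT)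
open Summit.QuantumFields.BalabanUV.T4Continuum.NE2BalabanGauge

variable {d : ℕ} (L : ℕ) [NeZero L] (M : Fin d → ℕ) [hM : ∀ μ, NeZero (M μ)] (a : ℝ) (ha : 0 < a)
variable {o : Type*} [Fintype o] [DecidableEq o]
variable {R : (k : ℕ) → Fin d → (Tor (fine (lev L k) M) → Matrix o o ℂ)} {T : (k : ℕ) → Tor (fine (lev L k) M) → Matrix o o ℂ} {a' : ℝ}

/-! ## §0 File 3's constants are leaf-08's `NE2BalabanClosure` constants -/

section Bridge

/-- `kappaGS = NE2BalabanClosure.kappa4S` (definitionally). [folklore] -/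
theorem kappaGS_eq_kappa4S (d : ℕ) (a a' κs α τ : ℝ) : kappaGS d a a' κs α τ = NE2BalabanClosure.kappa4S d a a' κs α τ := rfl

/-- `GaugeTermInstanceGeom.C4S = NE2BalabanClosure.C4S` (definitionally). [folklore] -/
theorem C4S_eq_closure (d L : ℕ) (a a' κs α β β' τ C₀ C₁ C₂ CT : ℝ) :
    GaugeTermInstanceGeom.C4S d L a a' κs α β β' τ C₀ C₁ C₂ CT = NE2BalabanClosure.C4S d L a a' κs α β β' τ C₀ C₁ C₂ CT := rfl

end Bridge

/-- **`C₄` OF THE B4 SLOT ON ROW DATA**: file 3's `C4S` at `κs = kappaS d a′ α β τ`, the free defects' constants `C₀ = 2d√(γ′⁻¹)`,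
`C₁ = 2d√(γ′⁻¹) + CX d a′` (row B4.d), `C₂ = C2S …` (row B4.e) and `CT = τ′`. [folklore] -/
def C4data (d L : ℕ) (a a' α β β' ζ τ τ' : ℝ) : ℝ :=
  GaugeTermInstanceGeom.C4S d L a a' (kappaS d a' α β τ) α β β' τ (2 * d * Real.sqrt ((gammaPs d a')⁻¹))
    (2 * d * Real.sqrt ((gammaPs d a')⁻¹) + CX d a')
    (C2S d L a' α β β' ζ τ τ' (2 * d * Real.sqrt ((gammaPs d a')⁻¹)) (2 * d * Real.sqrt ((gammaPs d a')⁻¹) + CX d a')) τ'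

/-! ## §1 The binders of file 3 read off `ConnectionLaws0` -/

section ReadOff

variable {α β β' ζ τ τ' : ℝ}

omit [NeZero L] hM in
/-- size of the connection, `connL`-keyed. [folklore] -/
theorem connL_bound (hR : ConnectionLaws0 L M R α β β' ζ) (k : ℕ) (μ : Fin d) (i : Tor (fine (lev L k) M) × Fin d) :
    ‖connL (fine (lev L k) M) (cl L k) (R k) μ i‖ ≤ α :=
  hR.bound k μ i.1

omit [NeZero L] hM in
/-- lattice-Lipschitz bound of the connection, `connL`/`tau`-keyed. [folklore] -/
theorem connL_lipschitz (hR : ConnectionLaws0 L M R α β β' ζ) (k : ℕ) (μ lam : Fin d) (i : Tor (fine (lev L k) M) × Fin d) :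
    ‖connL (fine (lev L k) M) (cl L k) (R k) μ (tau (fine (lev L k) M) lam i) - connL (fine (lev L k) M) (cl L k) (R k) μ i‖
      ≤ β / (lev L k : ℕ) :=
  hR.lipschitz k μ lam i.1

omit [NeZero L] hM in
/-- two-level consistency of the connection at the block parent, `connL`/`parT`-keyed. [folklore] -/
theorem connL_consistent (hR : ConnectionLaws0 L M R α β β' ζ) (k : ℕ) (μ : Fin d) (i' : Tor (fine (lev L (k + 1)) M) × Fin d) :
    ‖connL (fine (lev L (k + 1)) M) (cl L (k + 1)) (R (k + 1)) μ i' - connL (fine (lev L k) M) (cl L k) (R k) μ (parT (lev L k) L M i')‖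
      ≤ β' / (lev L k : ℕ) :=
  hR.consistent k μ i'.1

end ReadOff

/-! ## §2 The gauge slot on row data: row B4.e's END by name -/

/-- **THE GAUGE SLOT's `PerturbationLaws` ON ROW DATA** (`d ≥ 1`, `a′ > 0`): the scalar tower's `FreeTowerLaws` keyed on `J0pcT ⊗ 1`
with geometric defects (row B4.d's shape), the connection's and the site transports' hypothesis structures `ConnectionLaws0` ∕
`SiteTransportLaws0` (row B4.e's data shapes), `kappaS d a′ α β τ < 1` and `σ₀⁻²·δK < 1` ⟹ the target shape for
`gaugeSlot R (QuT T) Q1 a′` — row B4.e's END `perturbationLaws_scalarLayer` consumed BY NAME.  NOT NE2; model level. [folklore] -/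
theorem perturbationLaws_gaugeSlot_data (hd : 1 ≤ d) (ha' : 0 < a')
    {A : (k : ℕ) → Matrix (Tor (fine (lev L k) M) × o) (Tor (fine (lev L (k + 1)) M) × o) ℂ}
    {F : (k : ℕ) → Matrix (Tor (fine (lev L k) M) × o) (Tor (fine (lev L k) M) × o) ℂ} {r : ℝ} {e₀ e₁ f : ℕ → ℝ} {C₀ C₁ : ℝ}
    (hfree : FreeTowerLaws (fun k => DeltaPs (lev L k) M a' ⊗ₖ (1 : Matrix o o ℂ)) A
      (fun k => J0pcT L M k ⊗ₖ (1 : Matrix o o ℂ)) F r e₀ e₁ f)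
    (he₀ : ∀ k, e₀ k ≤ C₀ * ((L : ℝ)⁻¹) ^ k) (he₁ : ∀ k, e₁ k ≤ C₁ * ((L : ℝ)⁻¹) ^ k)
    {α β β' ζ τ τ' : ℝ} (hR : ConnectionLaws0 L M R α β β' ζ) (hT : SiteTransportLaws0 L M T τ τ')
    (hκ : kappaS d a' α β τ < 1)
    (hsmall : ((sigma0 d a') ^ 2)⁻¹ * deltaK (gS d a' (kappaS d a' α β τ)) (1 + τ) (d * α) τ a' < 1) :
    PerturbationLaws (fun k => calDalev L M a ha k ⊗ₖ (1 : Matrix o o ℂ)) (gaugeSlot L M R (QuT L M o T) (Q1 L M o) a')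
      (fun k => JpcT L M k ⊗ₖ (1 : Matrix o o ℂ)) (kappaGS d a a' (kappaS d a' α β τ) α τ)
      (fun k => C4S d L a a' (kappaS d a' α β τ) α β β' τ C₀ C₁ (C2S d L a' α β β' ζ τ τ' C₀ C₁) τ' * ((L : ℝ)⁻¹) ^ k) :=
  perturbationLaws_gaugeSlot_scalar_site L M a ha R T a' ha' hd hfree (perturbationLaws_scalarLayer L M hd ha' hfree hR hT) hκ
    hR.nonneg.1 hR.nonneg.2.1 hR.nonneg.2.2.1 hT.nonneg.1 hT.nonneg.2 (connL_bound L M hR) (connL_lipschitz L M hR)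
    (connL_consistent L M hR) hT.sub_one_le hT.consistent he₀ he₁
    (e2S_le_geom L ha' hR.nonneg.1 hR.nonneg.2.1 hT.nonneg.1 he₀ he₁) hsmall

/-! ## §3 … and row B4.d's hypothesis-free END by name: every B4 binder a row's data shape -/

/-- **THE GAUGE SLOT WITH EVERY BINDER A ROW's DATA SHAPE** (`d ≥ 1`, `a′ > 0`): §2 with `hfree := freeTowerLaws_kron o
(freeTowerLaws_king_scalar …)` (row B4.d's END, hypothesis-free) — binders: row B4.e's `ConnectionLaws0` ∕ `SiteTransportLaws0`,
`kappaS d a′ α β τ < 1`, `σ₀⁻²·δK < 1`; constants `kappaGS d a a′ (kappaS d a′ α β τ) α τ`, `C4data d L a a′ α β β′ ζ τ τ′`.  NOT NE2; model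
level. [folklore] -/
theorem perturbationLaws_gaugeSlot_balabanData (hd : 1 ≤ d) (ha' : 0 < a')
    {α β β' ζ τ τ' : ℝ} (hR : ConnectionLaws0 L M R α β β' ζ) (hT : SiteTransportLaws0 L M T τ τ')
    (hκ : kappaS d a' α β τ < 1)
    (hsmall : ((sigma0 d a') ^ 2)⁻¹ * deltaK (gS d a' (kappaS d a' α β τ)) (1 + τ) (d * α) τ a' < 1) :
    PerturbationLaws (fun k => calDalev L M a ha k ⊗ₖ (1 : Matrix o o ℂ)) (gaugeSlot L M R (QuT L M o T) (Q1 L M o) a')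
      (fun k => JpcT L M k ⊗ₖ (1 : Matrix o o ℂ)) (kappaGS d a a' (kappaS d a' α β τ) α τ)
      (fun k => C4data d L a a' α β β' ζ τ τ' * ((L : ℝ)⁻¹) ^ k) :=
  perturbationLaws_gaugeSlot_data L M a ha hd ha'
    (freeTowerLaws_kron o (freeTowerLaws_king_scalar L M (Nat.lt_of_lt_of_le Nat.zero_lt_one hd) ha'))
    (fun _ => le_rfl) (fun _ => le_rfl) hR hT hκ hsmall

end Summit.QuantumFields.BalabanUV.T4Continuum.GaugeTermBalabanData

end
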